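import Summits.MatrixMultiplication.MatrixMultiplication.Theorems.AbelianSTPPCensusShapeCertBudgets
import Summits.MatrixMultiplication.MatrixMultiplication.Theorems.AbelianSTPPCensusShapeCertUniverse

/-!
# Abelian STPP census — soundness of the `ShapeCert` checker for crux `ShapeExclusionTE` (part 4: bound, admissibility test, search)

Cell mm-stpp, rung F-M1, route `AbelianSTPPCensus`; implementation B (seat eng-2).  The checker is defined in
`…Theorems.AbelianSTPPCensusShapeCertDefs`; the files `…ShapeCertSemantics` (shape arithmetic, the hereditary
sieve system `AdmM` on multisets of shapes, heredity), `…ShapeCertBudgets` (prefix aggregates versus the tail of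
an admissible family), `…ShapeCertUniverse` (volume buckets, the decorated candidate list, completeness of the
universe) and `…ShapeCertSearch` (the continuation bound, completeness of the admissibility test, the search
induction, `check_sound`) prove: `check M = true` ⇒ every `AdmM`-admissible shape multiset inside the universe
with integer gain `> 10⁶·M` contains a registered residual sub-multiset.
-/

set_option linter.dupNamespace false -- `MatrixMultiplication.MatrixMultiplication` (summit = problem, D-0017)
set_option autoImplicit false


namespace Summit.MatrixMultiplication.MatrixMultiplication.Theorems.ShapeCert

open Multiset

section bound
/-! ### The continuation bound -/

variable {M : ℕ} {G : Multiset (ℕ × ℕ × ℕ)} {fam : List Sh}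

/-- the scaled ratio dominates gain over packing weight: `g·K ≤ rho·(ab+bc+ca)` -/
theorem rho_mul_ge {x : ℕ × ℕ × ℕ} (hU : InUniv M x) : gainOf (vol x) * K ≤ (shOf M x).rho * uu x := by
  rw [shOf_rho, Nat.add_mul, Nat.one_mul]
  exact (Nat.lt_div_mul_add hU.uu_pos).le

/-- `Σ (ab+bc+ca)` splits into the three pair-product sums -/
theorem sum_uu_eq (T : Multiset (ℕ × ℕ × ℕ)) :
    (T.map uu).sum = (T.map pab).sum + (T.map pbc).sum + (T.map pca).sum := by
  have : (T.map uu) = T.map (fun x => (pab x + pbc x) + pca x) := rfl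
  rw [this, Multiset.sum_map_add, Multiset.sum_map_add]

/-- the three U11 weights add up to twice the packing weight -/
theorem sum_w_eq (T : Multiset (ℕ × ℕ × ℕ)) :
    (T.map wa).sum + (T.map wb).sum + (T.map wc).sum = 2 * (T.map uu).sum := by
  rw [← Multiset.sum_map_add, ← Multiset.sum_map_add, ← Multiset.sum_map_mul_left]
  congr 1; apply Multiset.map_congr rfl
  intro x _; unfold wa wb wc uu pab pbc pca; ring

/-- the tail's packing weight fits the budget `q0` -/
theorem Above.tail_uu (h : Above M G fam) : ((G - famT fam).map uu).sum ≤ (aggOf M fam).q0 M := by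
  have p1 := h.tail_pab; have p2 := h.tail_pbc; have p3 := h.tail_pca
  have t1 := h.tail_wa; have t2 := h.tail_wb; have t3 := h.tail_wc
  have e1 := sum_uu_eq (G - famT fam); have e2 := sum_w_eq (G - famT fam)
  unfold Agg.q0 Agg.ra Agg.rb Agg.rc aggOf
  simp only
  refine le_min (by omega) ?_
  rw [Nat.le_div_iff_mul_le (by norm_num)]
  omega

/-- every tail member fits the bucket `kOf` -/
theorem Above.tail_capOK (h : Above M G fam) {x : ℕ × ℕ × ℕ} (hx : x ∈ G - famT fam) :
    capOK ((aggOf M fam).kOf M) (vol x) = true := by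
  have hxG := mem_G_of_tail hx
  have hU := h.univ x hxG
  obtain ⟨v1, v2, v3, v4⟩ := h.tail_vol hx
  have hq := h.tail_uu
  have ux : uu x ≤ ((G - famT fam).map uu).sum := Multiset.le_sum_of_mem (Multiset.mem_map_of_mem uu hx)
  have w1 := Multiset.le_sum_of_mem (Multiset.mem_map_of_mem wa hx)
  have w2 := Multiset.le_sum_of_mem (Multiset.mem_map_of_mem wb hx)
  have w3 := Multiset.le_sum_of_mem (Multiset.mem_map_of_mem wc hx)
  have t1 := h.tail_wa; have t2 := h.tail_wb; have t3 := h.tail_wc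
  unfold Agg.kOf
  refine capOK_min3 ?_ ?_ ?_
  · -- volume cap
    refine capOK_of_le ?_ (capOK_bucketOf _)
    unfold Agg.vl Agg.mc aggOf; simp only
    have : max (max (sab fam) (max (sbc fam) (sca fam))) (mxP fam) ≤ M - vol x :=
      max_le (max_le (by omega) (max_le (by omega) (by omega))) (by omega)
    omega
  · -- packing budget
    apply capOK_kU
    have h27 := vol_sq_le_uu_cube x
    have : uu x ^ 3 ≤ (aggOf M fam).q0 M ^ 3 := Nat.pow_le_pow_left (ux.trans hq) 3
    omega
  · -- U11 budgets
    apply capOK_kR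
    have ha : wa x ≤ (aggOf M fam).ra M := by unfold Agg.ra aggOf; simp only; omega
    have hb : wb x ≤ (aggOf M fam).rb M := by unfold Agg.rb aggOf; simp only; omega
    have hc : wc x ≤ (aggOf M fam).rc M := by unfold Agg.rc aggOf; simp only; omega
    have qa := hU.four_vol_le_wa_sq; have qb := hU.four_vol_le_wb_sq; have qc := hU.four_vol_le_wc_sq
    have ma := Nat.mul_self_le_mul_self ha; have mb := Nat.mul_self_le_mul_self hb
    have mc := Nat.mul_self_le_mul_self hc
    rcases min_choice ((aggOf M fam).rb M) ((aggOf M fam).rc M) with e | e <;> rw [e] <;>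
      rcases min_choice ((aggOf M fam).ra M) _ with e' | e' <;> rw [e'] <;> omega

/-- **The continuation bound.** Any admissible family above the prefix whose tail lies in the pool `R`
has total gain at most the prefix gain plus `bndOf` (all scaled by `K`), `B` dominating the pool's ratios. -/
theorem Above.gsum_le (h : Above M G fam) {R : List Sh} {B : B8}
    (hR : ∀ x ∈ G - famT fam, shOf M x ∈ R) (hB : ∀ t ∈ R, ∀ k, capOK k t.V = true → t.rho ≤ B.get k) :
    gsumM G * K ≤ gs fam * K + (aggOf M fam).bnd M B := by
  have hsplit : gsumM G = gs fam + gsumM (G - famT fam) := by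
    unfold gsumM; rw [gs_eq h.wf]; exact sum_map_split h.le _
  by_cases hd : (aggOf M fam).dead M = true
  · rw [hsplit, h.tail_eq_zero_of_dead hd]; simp [gsumM]
  rw [Agg.bnd, if_neg hd, hsplit, Nat.add_mul]
  apply Nat.add_le_add_left
  have hq := h.tail_uu
  calc gsumM (G - famT fam) * K
      = ((G - famT fam).map fun x => gainOf (vol x) * K).sum := by
        unfold gsumM; rw [Multiset.sum_map_mul_right]
    _ ≤ ((G - famT fam).map fun x => B.get ((aggOf M fam).kOf M) * uu x).sum := by
        apply Multiset.sum_map_le_sum_map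
        intro x hx
        have hU := h.univ x (mem_G_of_tail hx)
        refine (rho_mul_ge hU).trans (Nat.mul_le_mul_right _ ?_)
        exact hB _ (hR x hx) _ (by rw [shOf_V]; exact h.tail_capOK hx)
    _ = B.get ((aggOf M fam).kOf M) * ((G - famT fam).map uu).sum := by
        rw [Multiset.sum_map_mul_left]
    _ ≤ B.get ((aggOf M fam).kOf M) * (aggOf M fam).q0 M := Nat.mul_le_mul_left _ hq

/-- the pruning test certifies `gain + bound ≤ 10⁶·M` (scaled by `K`) -/
theorem prune_sound {A : Agg} {M : ℕ} {B : B8} (hp : A.prune M B = true) :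
    A.gs * K + A.bnd M B ≤ M * D * K := by
  unfold Agg.prune at hp; unfold Agg.bnd
  by_cases hd : A.dead M = true
  · rw [if_pos hd] at hp ⊢; simp only [decide_eq_true_eq] at hp
    simpa using Nat.mul_le_mul_right K hp
  · rw [if_neg hd] at hp ⊢; simp only [seqN_eq, decide_eq_true_eq] at hp
    exact hp

/-- no admissible family through a pruned prefix beats -/
theorem Above.not_beat_of_le (h : Above M G fam) {R : List Sh} {B : B8}
    (hR : ∀ x ∈ G - famT fam, shOf M x ∈ R) (hB : ∀ t ∈ R, ∀ k, capOK k t.V = true → t.rho ≤ B.get k)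
    (hle : gs fam * K + (aggOf M fam).bnd M B ≤ M * D * K) : ¬ M * D < gsumM G := by
  have := (h.gsum_le hR hB).trans hle
  have := Nat.le_of_mul_le_mul_right this (show 0 < K by decide)
  omega

end bound

section feas
/-! ### The admissibility test accepts every admissible extension -/

variable {M : ℕ}

/-- the gain component of the aggregate record -/
theorem aggOf_gs (M : ℕ) (fam : List Sh) : (aggOf M fam).gs = gs fam := rfl

/-- aggregates of an extended prefix, incrementally -/
theorem aggOf_cons (M : ℕ) (t : Sh) (fam : List Sh) : aggOf M (t :: fam) = (aggOf M fam).push t := by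
  simp [aggOf, Agg.push, gs, sA, sB, sC, sab, sbc, sca, dAB, dBC, dCA, mxP, mxV, mnA, mnB, mnC]

/-- the U14-T″ test from the three implications -/
theorem t2ok_of {M sab sbc sca : ℕ} {l : Sh}
    (h1 : l.V - l.ab + sab = M → l.V - l.bc + sbc = M → hasLCD l.V M (l.a * l.c) = true)
    (h2 : l.V - l.bc + sbc = M → l.V - l.ca + sca = M → hasLCD l.V M (l.b * l.a) = true)
    (h3 : l.V - l.ca + sca = M → l.V - l.ab + sab = M → hasLCD l.V M (l.c * l.b) = true) :
    t2ok M sab sbc sca l = true := by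
  unfold t2ok
  simp only
  cases p : (l.V - l.ab + sab == M) <;> cases q : (l.V - l.bc + sbc == M) <;>
    cases r : (l.V - l.ca + sca == M) <;> simp_all [beq_iff_eq]

/-- **Completeness of the admissibility test**: an admissible extension is never rejected -/
theorem feasA_complete {t : Sh} {fam : List Sh} (h : Above M (famT (t :: fam)) (t :: fam)) :
    feasA M t (aggOf M fam) fam = true := by
  have hz : famT (t :: fam) - famT (t :: fam) = 0 := tsub_self _
  have u1 := h.tail_wa; have u2 := h.tail_wb; have u3 := h.tail_wc
  have p1 := h.tail_pab; have p2 := h.tail_pbc; have p3 := h.tail_pca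
  rw [hz] at u1 u2 u3 p1 p2 p3
  simp only [Multiset.map_zero, Multiset.sum_zero, zero_add] at u1 u2 u3 p1 p2 p3
  obtain ⟨⟨q1, q2, q3⟩, -, h9, h14, hT⟩ := h.adm
  rw [← sab_eq h.wf] at q1; rw [← sbc_eq h.wf] at q2; rw [← sca_eq h.wf] at q3
  have htU : InUniv M t.tr := h.univ _ (tr_mem_famT (by simp))
  -- U9′ of the new member against the earlier ones
  have h9a : ∀ l ∈ fam, t.mpp + l.V ≤ M ∧ l.mpp + t.V ≤ M := by
    intro l hl
    have hlF : l.tr ∈ famT (t :: fam) := tr_mem_famT (List.mem_cons_of_mem _ hl)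
    have htF : t.tr ∈ famT (t :: fam) := tr_mem_famT (by simp)
    have e1 : famT (t :: fam) = t.tr ::ₘ famT fam := rfl
    have m1 : l.tr ∈ (famT (t :: fam)).erase t.tr := by
      rw [e1, Multiset.erase_cons_head]; exact tr_mem_famT hl
    have m2 : t.tr ∈ (famT (t :: fam)).erase l.tr := by
      by_cases he : l.tr = t.tr
      · rw [he, e1, Multiset.erase_cons_head, ← he]; exact tr_mem_famT hl
      · rw [e1, Multiset.erase_cons_tail _ (Ne.symm he)] ; exact Multiset.mem_cons_self _ _
    have a := h9 t.tr htF l.tr m1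
    have b := h9 l.tr hlF t.tr m2
    have wt := h.wf t (by simp); have wl := h.wf l (List.mem_cons_of_mem _ hl)
    have em := congrArg Sh.mpp wt; have ev := congrArg Sh.V wt
    have em' := congrArg Sh.mpp wl; have ev' := congrArg Sh.V wl
    rw [shOf_mpp] at em em'; rw [shOf_V] at ev ev'
    constructor <;> omega
  -- U14-T″ per member
  have hT2 : ∀ l ∈ t :: fam, t2ok M (sab (t :: fam)) (sbc (t :: fam)) (sca (t :: fam)) l = true := by
    intro l hl
    have hlF : l.tr ∈ famT (t :: fam) := tr_mem_famT hl
    obtain ⟨x1, x2, x3⟩ := hT l.tr hlF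
    have s1 := h.erase_split hl pab; have s2 := h.erase_split hl pbc; have s3 := h.erase_split hl pca
    rw [hz] at s1 s2 s3
    simp only [Multiset.map_zero, Multiset.sum_zero, add_zero] at s1 s2 s3
    rw [← sab_eq h.wf] at s1; rw [← sbc_eq h.wf] at s2; rw [← sca_eq h.wf] at s3
    have hUl := h.univ _ hlF
    have v1 := hUl.pab_le_vol; have v2 := hUl.pbc_le_vol; have v3 := hUl.pca_le_vol
    have wl := h.wf l hl
    have eV := congrArg Sh.V wl; have eab := congrArg Sh.ab wl; have ebc := congrArg Sh.bc wl
    have eca := congrArg Sh.ca wl; have ea := congrArg Sh.a wl; have eb := congrArg Sh.b wl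
    have ec := congrArg Sh.c wl
    rw [shOf_V] at eV; rw [shOf_ab] at eab; rw [shOf_bc] at ebc; rw [shOf_ca] at eca
    rw [shOf_a] at ea; rw [shOf_b] at eb; rw [shOf_c] at ec
    apply t2ok_of
    · intro ha hb; rw [eV, ea, ec]; exact x1 (by omega) (by omega)
    · intro ha hb; rw [eV, eb, ea]; exact x2 (by omega) (by omega)
    · intro ha hb; rw [eV, ec, eb]; exact x3 (by omega) (by omega)
  have hmpp := htU.mpp_le
  have hVt : t.V ≤ M := by
    have := htU.vol_le; have ev := congrArg Sh.V (h.wf t (by simp)); rw [shOf_V] at ev; omega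
  have emt := congrArg Sh.mpp (h.wf t (by simp)); rw [shOf_mpp] at emt
  rw [feasA, Agg.force_eq, ← aggOf_cons]
  unfold feasP
  simp only [aggOf, Bool.and_eq_true, decide_eq_true_eq, Bool.or_eq_true, List.all_eq_true, Bool.not_not]
  refine ⟨⟨⟨⟨⟨⟨⟨⟨⟨⟨u1, u2⟩, u3⟩, q1⟩, q2⟩, q3⟩, by omega⟩, by omega⟩, by omega⟩, ?_⟩, hT2⟩
  by_cases he : fam = []
  · left; simp [he]
  · right
    constructor
    · have : mxV fam ≤ M - t.mpp := mxV_le fun l hl => by have := (h9a l hl).1; omega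
      omega
    · have : mxP fam ≤ M - t.V := mxP_le fun l hl => by have := (h9a l hl).2; omega
      omega

end feas

section search
/-! ### The search is sound -/

variable {M : ℕ}

/-- `List.count` does not depend on the (lawful) `BEq` instance used -/
theorem count_prod_eq (x : ℕ × ℕ × ℕ) (l : List (ℕ × ℕ × ℕ)) :
    @List.count _ instBEqProd x l = @List.count _ instBEqOfDecidableEq x l := by
  induction l with
  | nil => rfl
  | cons y l ih => simp [List.count_cons, ih, beq_iff_eq]

/-- the residual test certifies a residual sub-multiset -/
theorem residB_sound {fam : List Sh} (h : residB M fam = true) : ResidM M (famT fam) := by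
  unfold residB at h
  rw [List.any_eq_true] at h
  obtain ⟨L, hL, hd⟩ := h
  refine ⟨L, hL, ?_⟩
  unfold domB at hd; rw [List.all_eq_true] at hd
  exact coe_le_coe_of_count fun x hx => by
    have := hd x hx; rw [decide_eq_true_eq, count_prod_eq, count_prod_eq] at this; exact this

/-- What the search below the prefix `fam` with candidate pool `R` guarantees. -/
def Goal (M : ℕ) (fam R : List Sh) : Prop :=
  ∀ G : Multiset (ℕ × ℕ × ℕ), Above M G fam → M * D < gsumM G →
    (∀ x ∈ G - famT fam, shOf M x ∈ R) → ResidM M G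

/-- one unfolding of `dfs` -/
theorem dfs_succ (M n : ℕ) (fam : List Sh) (L : List (Sh × B8)) :
    dfs M (n + 1) fam L =
      (if M * D < gs fam then residB M fam
       else if (aggOf M fam).dead M then true
       else loop M (dfs M n) fam (aggOf M fam) ((aggOf M fam).ra M) ((aggOf M fam).rb M)
          ((aggOf M fam).rc M) ((aggOf M fam).vl M) (gs fam * K) ((aggOf M fam).q0 M)
          (selOf ((aggOf M fam).kOf M)) (M * D * K) L) := by
  simp only [dfs, Agg.force_eq, seqN_eq]; rfl

/-- a goal with no tail member left in the pool -/
theorem goal_of_pool_empty {fam : List Sh} (hnb : ¬ M * D < gs fam) {G : Multiset (ℕ × ℕ × ℕ)}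
    (hG : Above M G fam) (hbeat : M * D < gsumM G) (h0 : G - famT fam = 0) : ResidM M G := by
  exfalso
  have : gsumM G = gs fam := by
    unfold gsumM; rw [gs_eq hG.wf, sum_map_split hG.le, h0]; simp [gsumM]
  omega

/-- **Soundness of one level of the walk** (induction on the candidate list) -/
theorem loop_sound (M n : ℕ) (fam : List Sh) (hwf : WfL M fam)
    (IH : ∀ fam' R', WfL M fam' → WfL M R' → (∀ t ∈ R', InUniv M t.tr) →
      dfs M n fam' (sufMax R') = true → Goal M fam' R')
    (hnb : ¬ M * D < gs fam) (hnd : ¬ (aggOf M fam).dead M = true) :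
    ∀ R : List Sh, WfL M R → (∀ t ∈ R, InUniv M t.tr) →
      loop M (dfs M n) fam (aggOf M fam) ((aggOf M fam).ra M) ((aggOf M fam).rb M) ((aggOf M fam).rc M)
        ((aggOf M fam).vl M) (gs fam * K) ((aggOf M fam).q0 M) (selOf ((aggOf M fam).kOf M)) (M * D * K)
        (sufMax R) = true → Goal M fam R
  | [], _, _, _ => by
    intro G hG hbeat hpool
    exact goal_of_pool_empty hnb hG hbeat
      (Multiset.eq_zero_of_forall_notMem fun x hx => by simpa using hpool x hx)
  | t :: R', hwR, hUR, hloop => by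
    intro G hG hbeat hpool
    have hwR' : WfL M R' := fun s hs => hwR s (List.mem_cons_of_mem _ hs)
    have hUR' : ∀ s ∈ R', InUniv M s.tr := fun s hs => hUR s (List.mem_cons_of_mem _ hs)
    have hdom : ∀ s ∈ t :: R', ∀ k, capOK k s.V = true → s.rho ≤ (bvec t R').get k := by
      intro s hs k hk; have := sufMax_dom (t :: R') s hs k hk; rwa [sufMax_cons] at this
    rw [sufMax_cons] at hloop
    simp only [loop] at hloop
    -- the walk stops: nothing below beats
    by_cases hbr : gs fam * K + selOf ((aggOf M fam).kOf M) (bvec t R') * (aggOf M fam).q0 M ≤ M * D * K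
    · exfalso
      refine hG.not_beat_of_le hpool hdom ?_ hbeat
      rw [Agg.bnd, if_neg hnd, ← selOf_eq]; exact hbr
    rw [if_neg hbr] at hloop
    -- pool restricted to `R'` when `t` is not (the record of) a tail member
    have hpool' : t.tr ∉ G - famT fam → ∀ x ∈ G - famT fam, shOf M x ∈ R' := by
      intro ht x hx
      rcases List.mem_cons.mp (hpool x hx) with he | he
      · exfalso; apply ht; rw [← he, shOf_tr]; exact hx
      · exact he
    by_cases hch : (aggOf M fam).ra M < t.wA ∨ (aggOf M fam).rb M < t.wB ∨ (aggOf M fam).rc M < t.wC ∨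
        (aggOf M fam).vl M < t.V
    · -- cheap reject: `t` cannot be a tail member
      rw [if_pos hch] at hloop
      refine loop_sound M n fam hwf IH hnb hnd R' hwR' hUR' hloop G hG hbeat (hpool' fun hx => ?_)
      have hU := hG.univ _ (mem_G_of_tail hx)
      have w1 := Multiset.le_sum_of_mem (Multiset.mem_map_of_mem wa hx)
      have w2 := Multiset.le_sum_of_mem (Multiset.mem_map_of_mem wb hx)
      have w3 := Multiset.le_sum_of_mem (Multiset.mem_map_of_mem wc hx)
      have t1 := hG.tail_wa; have t2 := hG.tail_wb; have t3 := hG.tail_wc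
      obtain ⟨v1, v2, v3, v4⟩ := hG.tail_vol hx
      have wt := hwR t (by simp)
      have ea := congrArg Sh.wA wt; have eb := congrArg Sh.wB wt; have ec := congrArg Sh.wC wt
      have ev := congrArg Sh.V wt
      rw [shOf_wA] at ea; rw [shOf_wB] at eb; rw [shOf_wC] at ec; rw [shOf_V] at ev
      unfold Agg.ra Agg.rb Agg.rc Agg.vl Agg.mc aggOf at hch; simp only at hch
      have hm : max (max (sab fam) (max (sbc fam) (sca fam))) (mxP fam) ≤ M - vol t.tr :=
        max_le (max_le (by omega) (max_le (by omega) (by omega))) (by omega)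
      omega
    rw [if_neg hch, Bool.and_eq_true] at hloop
    obtain ⟨hstep, hrest⟩ := hloop
    by_cases hx : t.tr ∈ G - famT fam
    · -- extend the prefix by `t`
      have hwf1 : WfL M (t :: fam) := by
        intro s hs; rcases List.mem_cons.mp hs with rfl | hs
        · exact hwR s (by simp)
        · exact hwf s hs
      have hle1 : famT (t :: fam) ≤ G := cons_le_of_mem_sub hG.le hx
      have hG1 : Above M G (t :: fam) := ⟨hG.univ, hG.adm, hwf1, hle1⟩
      have hF : Above M (famT (t :: fam)) (t :: fam) :=
        ⟨fun x hx' => hG.univ x (Multiset.mem_of_le hle1 hx'), hG.adm.mono hle1, hwf1, le_rfl⟩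
      rw [feasA_complete hF] at hstep
      simp only [if_true] at hstep
      have hpool1 : ∀ x ∈ G - famT (t :: fam), shOf M x ∈ t :: R' :=
        fun x hx' => hpool x (Multiset.mem_of_le (sub_cons_le _ _ _) hx')
      by_cases hpr : ((aggOf M fam).push t).prune M (bvec t R') = true
      · exfalso
        rw [← aggOf_cons] at hpr
        have hp := prune_sound hpr
        rw [aggOf_gs] at hp
        exact hG1.not_beat_of_le hpool1 hdom hp hbeat
      · rw [if_neg hpr, ← sufMax_cons] at hstep
        exact IH (t :: fam) (t :: R') hwf1 hwR hUR hstep G hG1 hbeat hpool1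
    · exact loop_sound M n fam hwf IH hnb hnd R' hwR' hUR' hrest G hG hbeat (hpool' hx)

/-- **Soundness of the search** (induction on the fuel) -/
theorem dfs_sound (M : ℕ) : ∀ (n : ℕ) (fam R : List Sh), WfL M fam → WfL M R → (∀ t ∈ R, InUniv M t.tr) →
    dfs M n fam (sufMax R) = true → Goal M fam R
  | 0, fam, R, _, _, _, h => by simp [dfs] at h
  | n + 1, fam, R, hwf, hwR, hUR, h => by
    rw [dfs_succ] at h
    intro G hG hbeat hpool
    by_cases hb : M * D < gs fam
    · rw [if_pos hb] at h
      exact (residB_sound h).mono hG.le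
    rw [if_neg hb] at h
    by_cases hd : (aggOf M fam).dead M = true
    · exact goal_of_pool_empty hb hG hbeat (hG.tail_eq_zero_of_dead hd)
    rw [if_neg hd] at h
    exact loop_sound M n fam hwf (fun fam' R' => dfs_sound M n fam' R') hb hd R hwR hUR h G hG hbeat hpool

/-- **Soundness of the checker.** If `check M` succeeds, every admissible shape multiset inside the
universe whose integer gain exceeds `10⁶·M` contains one of the registered residual sub-multisets. -/
theorem check_sound {M : ℕ} (h : check M = true) (G : Multiset (ℕ × ℕ × ℕ))
    (hU : ∀ x ∈ G, InUniv M x) (hA : AdmM M G) (hbeat : M * D < gsumM G) : ResidM M G :=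
  dfs_sound M (M + 2) [] (univ M) (fun _ h => by simp at h) (univ_wf M) (univ_inUniv M) h G
    ⟨hU, hA, fun _ h => by simp at h, by simp [famT]⟩ hbeat
    (fun x hx => shOf_mem_univ (hU x (mem_G_of_tail hx)))

end search

end Summit.MatrixMultiplication.MatrixMultiplication.Theorems.ShapeCert
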